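import Summits.CriticalPhenomena.PercolationContinuityZ3.Theorems.PercNearOneGluingNoHeavyQuantSliceDeepLowsWitness
import Summits.CriticalPhenomena.PercolationContinuityZ3.Theorems.PercNearOneGluingNoHeavyQuantCornerWitness
import Summits.CriticalPhenomena.PercolationContinuityZ3.Theorems.PercNearOneGluingNoHeavyQuantCornerLayerRestrict
import Summits.CriticalPhenomena.PercolationContinuityZ3.Theorems.PercNearOneGluingNoHeavyQuantFlowSplit
import HarnessLib

/-!
# QUANT lane R8, T-DEC: SL-λ* with TRUE MIDS BELOW THE WINDOW (Theorem C, part 1) — the `M_b` sub-flow of the corner witness and the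
# pool budget through the corner identity (LEAD-NOTES-G23 N50 (3))

builds on p205010 (kernel theorem, internal audit signed; external expert review pending)

Support file (`--supports stmt-CriticalPhenomena-4575`), QUANT lane lead seat prim-quant-lead (gen 23), rung R8 of
`run/shared/lean/prim/quant/LADDER.md`.  Three small definitions (`mbFlow`, `mbResidual`, `mbResidualFlow`) and theorems; standard axioms,
no sorries.  Builds on Theorem A's budget (`…SliceDeepLowsBudget/Pool/Witness`), the corner identity (`…CornerLayerRestrict`), the named
corner witness (`…CornerWitness`) and the sub-flow splitting (`…FlowSplit`).

THEOREM C (`…QuantSliceMidsBelow`): as Theorem A (deep lows, band-like atoms `≤ λ`, window true mids `> λ`, giants; `g ≥ 1/2`), but the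
charged non-low atoms `k ≤ λ` may ALSO be true mids below the window (`2k > T′` with `k + a ≤ j′`).  ARCHITECTURE: take the CORNER witness at
layer `j′`; its flow into the columns `h` with `h + a ≤ j′` (`mbFlow`; all `≤ λ`) is the SAME at layer `λ` (corner identity), so (i) that part is sliced COMPONENTWISE
(each component `{l, k; pairGate}` has `k + a ≤ j′`: `bdecAtT_subflowLaw` + the typer's `slice_decAtT_of_bdecAtT'`), and (ii) the residual law
`mbResidual` with the residual flow `mbResidualFlow` satisfies Theorem A's core with the pool budget proved HERE: for a deep low the residual
mass is exactly the `λ`-run's giant-bound mass (`residual_low_eq_leftover`, by `cornerLeftover_restrict`), so `CornerSucceeds(λ)` is (H_λ) in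
pool form for the residual law, and `g·(H_λ) + (1−g)·(H_j′)` closes as in `pool_budget` (`pool_budget_midsBelow`).
EVIDENCE before the proof: exact router v4 (prim-quant-lead-g23/explore/g23_router4.py) 310/310 on supports of this family.

[this work]; nothing here is cited as a published result.  The gluing rows served [cite: KozmaNitzan2024, Conjecture 3 (p. 15)]; product
measure [cite: Grimmett1999, §1.3 p. 10].
-/

noncomputable section

namespace Summit.CriticalPhenomena.PercolationContinuityZ3.Theorems

namespace Quant

open Finset

namespace LawDec

/-! ### Theorem C: true mids below the window (LEAD-NOTES-G23 N50 (3)) -/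

section MidsBelow

variable (x T g : ℝ) (j' M a lam : ℕ) (ν : ℕ → ℝ)

/-- **the below-the-layer part of the corner witness**: the corner flow into the columns `h` with `h + a ≤ j′` (absorbers whose shifted
copy stays at or below the layer; for a law with deep lows only these are the true mids `M_b` below the window). [this work] -/
def mbFlow (x T : ℝ) (j' M a : ℕ) (ν : ℕ → ℝ) : ℕ → ℕ → ℝ := fun l h =>
  if h + a ≤ j' then cornerMidFlow x T j' M ν l h else 0

/-- `0 ≤ mbFlow ≤ cornerWitness`. -/
theorem mbFlow_nonneg_le (hx0 : 0 < x) (hx1 : x < 1) (hν : ∀ k, 0 ≤ ν k)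
    (hC : CornerSucceeds x T j' M ν) (l h : ℕ) :
    0 ≤ mbFlow x T j' M a ν l h ∧ mbFlow x T j' M a ν l h ≤ cornerWitness x T j' M ν l h := by
  obtain ⟨h0, -, -, -⟩ := cornerFlow_inv x T j' M ν hx0 hx1 hν ((j' + 1) * (j' + 1)) le_rfl
  have hW := (isFlowAtT_cornerWitness x T j' M ν hx0 hx1 hν hC).1 l h
  unfold mbFlow
  split_ifs with hc
  · rw [cornerWitness_of_le x T j' M ν l h (by omega)]
    exact ⟨h0 l h, le_rfl⟩
  · exact ⟨le_rfl, hW⟩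

/-- a charged pair of `mbFlow`: the column stays below the layer after the shift, is charged and compatible with its low. -/
theorem mbFlow_pos (hx0 : 0 < x) (hx1 : x < 1) (hν : ∀ k, 0 ≤ ν k) (l h : ℕ) (hp : 0 < mbFlow x T j' M a ν l h) :
    h + a ≤ j' ∧ l ≤ j' ∧ 2 * (l : ℝ) < T ∧ h ≤ M ∧ T < (l : ℝ) + h ∧ 0 < ν h := by
  obtain ⟨h0, hsup, -, hcol⟩ := cornerFlow_inv x T j' M ν hx0 hx1 hν ((j' + 1) * (j' + 1)) le_rfl
  unfold mbFlow at hp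
  split_ifs at hp with hc
  · obtain ⟨hl, hhj, hlow, hhM, hcomp, -⟩ := hsup l h hp.ne'
    have hlh : l < h := by
      have : (l : ℝ) < h := by linarith
      exact_mod_cast this
    have hu := usage_pos_of_compat x T j' l h hx0 hx1 hlow hlh (Or.inr hcomp)
    have hterm : usage x T j' l h * cornerMidFlow x T j' M ν l h
        ≤ ∑ l' ∈ Finset.range (j' + 1), usage x T j' l' h * cornerMidFlow x T j' M ν l' h := by
      refine Finset.single_le_sum (f := fun l' => usage x T j' l' h * cornerMidFlow x T j' M ν l' h)
        (fun l' _ => ?_) (Finset.mem_range.2 (by omega))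
      show 0 ≤ usage x T j' l' h * cornerMidFlow x T j' M ν l' h
      rcases (h0 l' h).eq_or_lt with hz | hp'
      · unfold cornerMidFlow; rw [← hz, mul_zero]
      · obtain ⟨-, -, hlow', -, hcomp', -⟩ := hsup l' h hp'.ne'
        have hl'h : l' < h := by
          have : (l' : ℝ) < h := by linarith
          exact_mod_cast this
        exact (mul_pos (usage_pos_of_compat x T j' l' h hx0 hx1 hlow' hl'h (Or.inr hcomp')) hp').le
    exact ⟨hc, hl, hlow, hhM, hcomp, lt_of_lt_of_le (lt_of_lt_of_le (mul_pos hu hp) hterm) (hcol h)⟩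
  · exact absurd hp (lt_irrefl _)

/-- **the residual low mass is the λ-run's giant-bound mass**: for a low `l ≤ λ` whose charged corner columns `h ≤ λ` all have
`h + a ≤ j′`, `ν l − Σ_h mbFlow l h = cornerLeftover x T λ M ν l` (corner identity `cornerLeftover_restrict`; `j′ ≤ λ + a`). [this work] -/
theorem residual_low_eq_leftover (hx0 : 0 < x) (hx1 : x < 1) (hν : ∀ k, 0 ≤ ν k) (hlamj : lam ≤ j') (hlam : j' ≤ lam + a)
    (l : ℕ) (hl : l ≤ lam) (hmids : ∀ h, h ≤ lam → 0 < cornerMidFlow x T j' M ν l h → h + a ≤ j') :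
    ν l - ∑ h ∈ Finset.range (M + 1), mbFlow x T j' M a ν l h = cornerLeftover x T lam M ν l := by
  obtain ⟨h0, -, -, -⟩ := cornerFlow_inv x T j' M ν hx0 hx1 hν ((j' + 1) * (j' + 1)) le_rfl
  rw [cornerLeftover_restrict x T j' M ν lam hx0 hx1 hν hlamj l hl]
  unfold cornerLeftover
  have e : ∀ h ∈ Finset.range (M + 1), mbFlow x T j' M a ν l h
      = cornerMidFlow x T j' M ν l h - (if lam < h then cornerMidFlow x T j' M ν l h else 0) := by
    intro h _
    unfold mbFlow
    by_cases hb : h + a ≤ j'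
    · rw [if_pos hb, if_neg (show ¬ (lam < h) by omega)]; ring
    · rw [if_neg hb]
      by_cases hh : lam < h
      · rw [if_pos hh]; ring
      · rw [if_neg hh]
        rcases (h0 l h).eq_or_lt with hz | hp
        · unfold cornerMidFlow; rw [← hz]; ring
        · exact absurd (hmids h (by omega) hp) hb
  rw [Finset.sum_congr rfl e, Finset.sum_sub_distrib]
  ring

/-- **the residual law of Theorem C**: `ν` minus the law carried by the `M_b` part of the corner witness. [this work] -/
def mbResidual (x T : ℝ) (j' M a : ℕ) (ν : ℕ → ℝ) : ℕ → ℝ :=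
  fun k => ν k - subflowLaw x T j' M (mbFlow x T j' M a ν) k

/-- **the residual flow of Theorem C**: the corner witness minus its `M_b` part. [this work] -/
def mbResidualFlow (x T : ℝ) (j' M a : ℕ) (ν : ℕ → ℝ) : ℕ → ℕ → ℝ :=
  fun l h => cornerWitness x T j' M ν l h - mbFlow x T j' M a ν l h

/-- **THE POOL BUDGET OF THEOREM C**: for the residual law `ν_R = ν − subflowLaw(mbFlow)` and the residual flow, the pool-bound mass fits into
the pool — `g·CornerSucceeds(λ) + (1−g)·(H_j′ restricted)` and the corner identity. [this work] -/
theorem pool_budget_midsBelow (hx0 : 0 < x) (hx1 : x < 1) (hg0 : 0 ≤ g) (hg1 : g ≤ 1) (hg2 : 1 / 2 ≤ g)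
    (hν : ∀ k, 0 ≤ ν k) (hνM : ∀ k, M < k → ν k = 0) (hlamj : lam ≤ j') (hlam : j' ≤ lam + a)
    (hCj : CornerSucceeds x T j' M ν) (hCl : CornerSucceeds x T lam M ν)
    (hdeep : ∀ k, k ≤ j' → 2 * (k : ℝ) < T → ν k ≠ 0 → 2 * ((k : ℝ) + a) < T + (a : ℝ) * g ∧ k + a ≤ j')
    (hbelow : ∀ k, k ≤ lam → T ≤ 2 * (k : ℝ) → ν k ≠ 0 → 2 * (k : ℝ) ≤ T + (a : ℝ) * g ∨ k + a ≤ j')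
    (habove : ∀ k, lam < k → k ≤ j' → ν k ≠ 0 → T + (a : ℝ) * g < 2 * (k : ℝ)) :
    x / (1 - x) * ∑ l ∈ Finset.range (j' + 1), (if 2 * (l : ℝ) < T then
        dlRest x T g j' a (mbResidual x T j' M a ν) (mbResidualFlow x T j' M a ν) l else 0)
      ≤ dlPoolTot g j' M lam (mbResidual x T j' M a ν) := by
  set fB := mbFlow x T j' M a ν with hfB
  have eνR : mbResidual x T j' M a ν = fun k => ν k - subflowLaw x T j' M fB k := rfl
  have efR : mbResidualFlow x T j' M a ν = fun l h => cornerWitness x T j' M ν l h - fB l h := rfl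
  rw [eνR, efR]
  set νR : ℕ → ℝ := fun k => ν k - subflowLaw x T j' M fB k with hνR
  set fR : ℕ → ℕ → ℝ := fun l h => cornerWitness x T j' M ν l h - fB l h with hfR
  have hu : 0 < x / (1 - x) := div_pos hx0 (by linarith)
  obtain ⟨hV0, hsup, hrow, hcol⟩ := cornerFlow_inv x T j' M ν hx0 hx1 hν ((j' + 1) * (j' + 1)) le_rfl
  have hW := isFlowAtT_cornerWitness x T j' M ν hx0 hx1 hν hCj
  have hB0 : ∀ l h, 0 ≤ fB l h := fun l h => (mbFlow_nonneg_le x T j' M a ν hx0 hx1 hν hCj l h).1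
  have hBle : ∀ l h, fB l h ≤ cornerWitness x T j' M ν l h :=
    fun l h => (mbFlow_nonneg_le x T j' M a ν hx0 hx1 hν hCj l h).2
  have hR : IsFlowAtT x T j' M νR fR := isFlowAtT_residual_of_subflow x T j' M ν _ fB hx0 hx1 hW hB0 hBle
  have hνR0 : ∀ k, 0 ≤ νR k := residual_nonneg_of_subflow x T j' M ν _ fB hx0 hx1 hνM hW hB0 hBle
  have hνRle : ∀ k, νR k ≤ ν k := fun k => by
    show ν k - subflowLaw x T j' M fB k ≤ ν k
    linarith [subflowLaw_nonneg x T j' M ν _ fB hx0 hx1 hW hB0 hBle k]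
  have hneR : ∀ k, νR k ≠ 0 → ν k ≠ 0 := fun k hk hz => hk (le_antisymm (by linarith [hνRle k]) (hνR0 k))
  have hdeepR : ∀ k, k ≤ j' → 2 * (k : ℝ) < T → νR k ≠ 0 → 2 * ((k : ℝ) + a) < T + (a : ℝ) * g ∧ k + a ≤ j' :=
    fun k hk hlow hne => hdeep k hk hlow (hneR k hne)
  -- (C) the key step for the residual datum
  have hC : (1 - g) * ∑ l ∈ Finset.range (j' + 1), (if 2 * (l : ℝ) < T then ∑ m ∈ Finset.range (j' + 1), fR l m else 0)
      ≤ ∑ l ∈ Finset.range (j' + 1), (if 2 * (l : ℝ) < T then ∑ m ∈ Finset.range (j' + 1), dlAd x T g j' a νR fR l m else 0) := by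
    rw [Finset.mul_sum]
    refine Finset.sum_le_sum fun l hl => ?_
    have hl' : l ≤ j' := Nat.lt_succ_iff.1 (Finset.mem_range.1 hl)
    split_ifs with hlow
    · exact sum_dlAd_ge x T g j' M a νR fR hx0 hx1 hg1 hg2 hνR0 hR hdeepR l hl' hlow
    · simp
  -- (B) (H_j′) in pool form for the residual datum
  have hB := pool_of_flow_top x T j' M νR fR hx0 hx1 hR
  -- (A) (H_λ) through the corner identity: u·Σ ν_R(lows) ≤ ν(>λ) = ν_R(>λ)
  have hνRlow : ∀ l, l ≤ j' → 2 * (l : ℝ) < T → νR l = cornerLeftover x T lam M ν l := by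
    intro l hl hlow
    have hcol0 : ∑ l' ∈ Finset.range (j' + 1), usage x T j' l' l * fB l' l = 0 :=
      subflow_col_low x T j' M ν _ fB hx0 hx1 hW hB0 hBle l hl hlow
    show ν l - subflowLaw x T j' M fB l = cornerLeftover x T lam M ν l
    unfold subflowLaw
    rw [hcol0, add_zero]
    by_cases hllam : l ≤ lam
    · refine residual_low_eq_leftover x T j' M a lam ν hx0 hx1 hν hlamj hlam l hllam fun h hh hp => ?_
      -- a charged corner pair (l,h) with h ≤ λ: ν l > 0, so l is deep; h is charged and non-low, so band-like or M_b; band-like is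
      -- incompatible with a deep low
      obtain ⟨-, -, -, hhM, hcomp, -⟩ := hsup l h hp.ne'
      have hνl : 0 < ν l := by
        have := hrow l
        have hle : cornerMidFlow x T j' M ν l h ≤ ∑ h' ∈ Finset.range (M + 1), cornerMidFlow x T j' M ν l h' :=
          Finset.single_le_sum (f := fun h' => cornerMidFlow x T j' M ν l h') (fun h' _ => hV0 l h') (Finset.mem_range.2 (by omega))
        unfold cornerMidFlow at hp hle this
        linarith
      have hd := (hdeep l hl hlow hνl.ne').1
      have h2 : T ≤ 2 * (h : ℝ) := by linarith
      have hνh : ν h ≠ 0 := by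
        have hpos := mbFlow_pos x T j' M a ν hx0 hx1 hν l h
        -- use the column bound directly
        have hlh : l < h := by
          have : (l : ℝ) < h := by linarith
          exact_mod_cast this
        have hupos := usage_pos_of_compat x T j' l h hx0 hx1 hlow hlh (Or.inr hcomp)
        have hterm : usage x T j' l h * cornerMidFlow x T j' M ν l h
            ≤ ∑ l' ∈ Finset.range (j' + 1), usage x T j' l' h * cornerMidFlow x T j' M ν l' h := by
          refine Finset.single_le_sum (f := fun l' => usage x T j' l' h * cornerMidFlow x T j' M ν l' h)
            (fun l' _ => ?_) (Finset.mem_range.2 (by omega))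
          show 0 ≤ usage x T j' l' h * cornerMidFlow x T j' M ν l' h
          rcases (hV0 l' h).eq_or_lt with hz | hp'
          · unfold cornerMidFlow; rw [← hz, mul_zero]
          · obtain ⟨-, -, hlow', -, hcomp', -⟩ := hsup l' h hp'.ne'
            have hl'h : l' < h := by
              have : (l' : ℝ) < h := by linarith
              exact_mod_cast this
            exact (mul_pos (usage_pos_of_compat x T j' l' h hx0 hx1 hlow' hl'h (Or.inr hcomp')) hp').le
        have := lt_of_lt_of_le (lt_of_lt_of_le (mul_pos hupos hp) hterm) (hcol h)
        exact this.ne'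
      rcases hbelow h hh h2 hνh with hb | hb
      · have ha0 : (0 : ℝ) ≤ a := Nat.cast_nonneg a
        exfalso; nlinarith
      · exact hb
    · -- lows above λ are uncharged: both sides vanish
      have hz : ν l = 0 := by
        by_contra hne; have := habove l (by omega) hl hne; linarith [mul_nonneg (Nat.cast_nonneg a) hg0]
      have hrow0 : ∀ h, cornerMidFlow x T j' M ν l h = 0 := by
        intro h
        have := hrow l
        have hle : cornerMidFlow x T j' M ν l h ≤ ∑ h' ∈ Finset.range (M + 1), cornerMidFlow x T j' M ν l h' := by
          by_cases hhM : h ≤ M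
          · exact Finset.single_le_sum (f := fun h' => cornerMidFlow x T j' M ν l h') (fun h' _ => hV0 l h')
              (Finset.mem_range.2 (by omega))
          · have : cornerMidFlow x T j' M ν l h = 0 := by
              by_contra hne; exact hhM (hsup l h hne).2.2.2.1
            rw [this]; exact Finset.sum_nonneg fun h' _ => hV0 l h'
        unfold cornerMidFlow at hle this ⊢
        linarith [hV0 l h]
      have hB0' : ∑ h ∈ Finset.range (M + 1), fB l h = 0 := Finset.sum_eq_zero fun h _ => by
        show mbFlow x T j' M a ν l h = 0
        unfold mbFlow; rw [hrow0 h]; split_ifs <;> rfl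
      rw [hB0', hz]
      -- leftover_λ(l) = ν l − Σ cornerMidFlow_λ l h = 0 − 0
      unfold cornerLeftover
      obtain ⟨hV0', hsup', hrow', -⟩ := cornerFlow_inv x T lam M ν hx0 hx1 hν ((lam + 1) * (lam + 1)) le_rfl
      have : ∑ h ∈ Finset.range (M + 1), cornerMidFlow x T lam M ν l h = 0 := by
        refine Finset.sum_eq_zero fun h _ => ?_
        by_contra hne
        exact absurd (hsup' l h hne).1 (by omega)
      rw [this, hz]
  have hA : x / (1 - x) * ∑ l ∈ Finset.range (j' + 1), (if 2 * (l : ℝ) < T then νR l else 0)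
      ≤ ∑ h ∈ Finset.Ico (lam + 1) (M + 1), ν h := by
    unfold CornerSucceeds at hCl
    rw [← Finset.sum_filter]
    have e : ∑ l ∈ (Finset.range (j' + 1)).filter (fun l : ℕ => 2 * (l : ℝ) < T), νR l
        = ∑ l ∈ (Finset.range (lam + 1)).filter (fun l : ℕ => 2 * (l : ℝ) < T), cornerLeftover x T lam M ν l := by
      symm
      refine Finset.sum_subset (Finset.filter_subset_filter _ (Finset.range_mono (show lam + 1 ≤ j' + 1 by omega))) ?_ |>.trans ?_
      · intro l hl hnl
        rw [Finset.mem_filter, Finset.mem_range] at hl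
        rw [Finset.mem_filter, Finset.mem_range, not_and] at hnl
        have hlam' : lam < l := by
          by_contra h; exact hnl (by omega) hl.2
        -- leftover of a low above λ vanishes: it is uncharged
        have hz : ν l = 0 := by
          by_contra hne; have := habove l hlam' (by omega) hne; linarith [mul_nonneg (Nat.cast_nonneg a) hg0]
        rw [← hνRlow l (by omega) hl.2]
        exact le_antisymm (by linarith [hνRle l]) (hνR0 l)
      · exact Finset.sum_congr rfl fun l hl => by
          rw [Finset.mem_filter, Finset.mem_range] at hl
          exact (hνRlow l (by omega) hl.2).symm
    rw [e]; exact hCl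
  have hνR_above : ∀ h, lam < h → νR h = ν h := by
    intro h hh
    show ν h - subflowLaw x T j' M fB h = ν h
    unfold subflowLaw
    have h1 : ∑ k ∈ Finset.range (M + 1), fB h k = 0 := by
      refine Finset.sum_eq_zero fun k _ => ?_
      rcases (hB0 h k).eq_or_lt with hz | hp
      · exact hz.symm
      · obtain ⟨-, hl, hlow, -⟩ := mbFlow_pos x T j' M a ν hx0 hx1 hν h k hp
        exfalso
        have hz : ν h = 0 := by
          by_contra hne; have := habove h hh hl hne; linarith [mul_nonneg (Nat.cast_nonneg a) hg0]
        have := hW.2.2.1 h hl hlow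
        have hle : cornerWitness x T j' M ν h k ≤ ∑ k' ∈ Finset.range (M + 1), cornerWitness x T j' M ν h k' :=
          Finset.single_le_sum (f := fun k' => cornerWitness x T j' M ν h k') (fun k' _ => hW.1 h k')
            (Finset.mem_range.2 (by have := (mbFlow_pos x T j' M a ν hx0 hx1 hν h k hp).2.2.2.1; omega))
        linarith [hBle h k]
    have h2 : ∑ l ∈ Finset.range (j' + 1), usage x T j' l h * fB l h = 0 := by
      refine Finset.sum_eq_zero fun l _ => ?_
      have : fB l h = 0 := by
        show mbFlow x T j' M a ν l h = 0
        unfold mbFlow; rw [if_neg (by omega)]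
      rw [this, mul_zero]
    rw [h1, h2]; ring
  have eG : ∑ h ∈ Finset.Ico (lam + 1) (M + 1), νR h = ∑ h ∈ Finset.Ico (lam + 1) (M + 1), ν h :=
    Finset.sum_congr rfl fun h hh => hνR_above h (by rw [Finset.mem_Ico] at hh; omega)
  -- assemble as in `pool_budget`
  have e : ∑ l ∈ Finset.range (j' + 1), (if 2 * (l : ℝ) < T then dlRest x T g j' a νR fR l else 0)
      = ∑ l ∈ Finset.range (j' + 1), (if 2 * (l : ℝ) < T then νR l else 0)
        - ∑ l ∈ Finset.range (j' + 1), (if 2 * (l : ℝ) < T then ∑ m ∈ Finset.range (j' + 1), dlAd x T g j' a νR fR l m else 0) := by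
    rw [← Finset.sum_sub_distrib]
    refine Finset.sum_congr rfl fun l _ => ?_
    unfold dlRest
    split_ifs <;> ring
  rw [e, mul_sub]
  unfold dlPoolTot
  rw [eG]
  set S := ∑ l ∈ Finset.range (j' + 1), (if 2 * (l : ℝ) < T then νR l else 0)
  set F := ∑ l ∈ Finset.range (j' + 1), (if 2 * (l : ℝ) < T then ∑ m ∈ Finset.range (j' + 1), fR l m else 0)
  set D := ∑ l ∈ Finset.range (j' + 1), (if 2 * (l : ℝ) < T then ∑ m ∈ Finset.range (j' + 1), dlAd x T g j' a νR fR l m else 0)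
  have h1 := mul_le_mul_of_nonneg_left hA hg0
  have h2 := mul_le_mul_of_nonneg_left hB (show 0 ≤ 1 - g by linarith)
  have h3 := mul_le_mul_of_nonneg_left hC hu.le
  have hmix : x / (1 - x) * S = g * (x / (1 - x) * S) + (1 - g) * (x / (1 - x) * S) := by ring
  nlinarith

end MidsBelow

end LawDec

end Quant

end Summit.CriticalPhenomena.PercolationContinuityZ3.Theorems
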